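import Literature.Probability.LatticeModels.TorusGreenHessianDecay
import HarnessLib

/-!
# Crux `SelfNormalisedSkewness` (stmt-QuantumFields-18944), line `Sketch`, stub `stub_torusGreenThirdDiff`:
# one-dimensional third-difference heat-kernel bounds

Helpers for the stub `stub_torusGreenThirdDiff` (third differences of the Green function of the
four-torus decay like `dist⁻⁵`). This file continues the chain
`SRWHeatKernel1D` → `SRWHeatKernelDifferences` → `TorusHeatKernel1D` of the Literature tree by ONE
more difference: for the heat kernel `q_t(m) = srwHeatKernel t m` of the continuous-time simple
random walk on `ℤ` and its periodisation `q^L_t = torusHeatKernel t` on `ℤ/Lℤ` we prove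

* `integral_pow_four_mul_exp_neg_mul_one_sub_cos_le`, `integral_abs_pow_three_mul_exp_neg_mul_one_sub_cos_le`
  — fourth and third moments of the heat weight `e^{-t(1 - cos k)}` on `[-π, π]`
  (`≲ (1∨t)^{-5/2}`, `≲ (1∨t)^{-2}`);
* `thirdDiff_srwHeatKernel_eq_integral`, `abs_thirdDiff_srwHeatKernel_le_exp`,
  `srwHeatKernel_thirdDiff_decay` — the third difference `q_t(m+1) - 3q_t(m) + 3q_t(m-1) - q_t(m-2)`
  as a shifted contour integral with multiplier `(e^{iz} - 1)(e^{-iz} - 1)²`, its Chernoff bound, and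
  the Gaussian-weighted decay `≤ A (1∨t)^{-2} (1 + m²/(1∨t))^{-p}`;
* `abs_torusHeatKernel_thirdDiff_le` — the periodised version on `ℤ/Lℤ` for `0 < t ≤ L²` (method of
  images, `abs_tsum_periodize_le`), `≤ K (1∨t)^{-2} (1 + m̃²/(1∨t))^{-3}`.

No named facts are used; everything is folklore heat-kernel calculus (cf. Lawler–Limic 2010, §2.3).
-/

noncomputable section

open MeasureTheory Set Filter intervalIntegral ZMod
open scoped Real Topology BigOperators
open Literature.Probability.LatticeModels

namespace Summit.QuantumFields.YangMills.Theorems.SelfNormalisedSkewness.Negative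

/-! ### Moments of the heat weight -/

/-- `x² e^{-x} ≤ 8 e^{-x/4}` for `x ≥ 0`. [folklore] -/
theorem sq_mul_exp_neg_le {x : ℝ} (hx : 0 ≤ x) : x ^ 2 * Real.exp (-x) ≤ 8 * Real.exp (-(x / 4)) := by
  have h1 := mul_exp_neg_le_two_mul_exp_neg_half x
  have h2 := mul_exp_neg_le_two_mul_exp_neg_half (x / 2)
  rw [show x / 2 / 2 = x / 4 by ring] at h2
  calc x ^ 2 * Real.exp (-x) = x * (x * Real.exp (-x)) := by ring
    _ ≤ x * (2 * Real.exp (-(x / 2))) := by gcongr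
    _ = 4 * (x / 2 * Real.exp (-(x / 2))) := by ring
    _ ≤ 4 * (2 * Real.exp (-(x / 4))) := by gcongr
    _ = 8 * Real.exp (-(x / 4)) := by ring

/-- **Fourth moment of the heat weight**:
`∫_{-π}^{π} k⁴ e^{-t(1 - cos k)} dk ≤ 6144 (1∨t)⁻² (1∨t)^{-1/2}` for `t ≥ 0` (trivially `≤ 2π⁵`; for
`t ≥ 1` through Jordan's inequality, `x² e^{-x} ≤ 8 e^{-x/4}` and the Gaussian integral). [folklore] -/
theorem integral_pow_four_mul_exp_neg_mul_one_sub_cos_le {t : ℝ} (ht : 0 ≤ t) :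
    ∫ k in (-π)..π, k ^ 4 * Real.exp (-(t * (1 - Real.cos k))) ≤
      6144 * ((max 1 t)⁻¹ * (max 1 t)⁻¹ * (max 1 t) ^ (-(1 / 2 : ℝ))) := by
  have hle : (-π : ℝ) ≤ π := by linarith [Real.pi_pos]
  have hcont : Continuous fun k : ℝ => k ^ 4 * Real.exp (-(t * (1 - Real.cos k))) := by
    fun_prop
  have hπ := Real.pi_pos
  have hπ4 := Real.pi_le_four
  -- the trivial bound
  have htriv : ∫ k in (-π)..π, k ^ 4 * Real.exp (-(t * (1 - Real.cos k))) ≤ 2 * π ^ 5 := by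
    calc ∫ k in (-π)..π, k ^ 4 * Real.exp (-(t * (1 - Real.cos k)))
        ≤ ∫ _ in (-π)..π, π ^ 4 := by
          refine intervalIntegral.integral_mono_on hle (hcont.intervalIntegrable _ _) (by simp)
            fun k hk => ?_
          have h1 : k ^ 4 ≤ π ^ 4 := by
            have h2 : k ^ 2 ≤ π ^ 2 := by
              rw [sq_le_sq, abs_of_pos hπ]
              exact abs_le.2 ⟨hk.1, hk.2⟩
            calc k ^ 4 = (k ^ 2) ^ 2 := by ring
              _ ≤ (π ^ 2) ^ 2 := pow_le_pow_left₀ (sq_nonneg _) h2 2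
              _ = π ^ 4 := by ring
          have h2 : Real.exp (-(t * (1 - Real.cos k))) ≤ 1 := by
            rw [Real.exp_le_one_iff, neg_nonpos]
            exact mul_nonneg ht (sub_nonneg.2 (Real.cos_le_one k))
          calc k ^ 4 * Real.exp (-(t * (1 - Real.cos k))) ≤ π ^ 4 * 1 :=
              mul_le_mul h1 h2 (Real.exp_pos _).le (by positivity)
            _ = π ^ 4 := mul_one _
      _ = 2 * π ^ 5 := by simp; ring
  rcases le_or_gt t 1 with h1 | h1
  · rw [max_eq_left h1, Real.one_rpow, inv_one, mul_one, mul_one, mul_one]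
    calc _ ≤ 2 * π ^ 5 := htriv
      _ ≤ 2 * 4 ^ 5 := by gcongr
      _ ≤ 6144 := by norm_num
  · rw [max_eq_right h1.le]
    have ht0 : 0 < t := by linarith
    set b : ℝ := 2 * t / π ^ 2 with hb
    have hb0 : 0 < b := by positivity
    have hgi := integrable_exp_neg_mul_sq (show 0 < b / 4 by positivity)
    calc ∫ k in (-π)..π, k ^ 4 * Real.exp (-(t * (1 - Real.cos k)))
        ≤ ∫ k in (-π)..π, 8 / b ^ 2 * Real.exp (-(b / 4) * k ^ 2) := by
          refine intervalIntegral.integral_mono_on hle (hcont.intervalIntegrable _ _)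
            ((hgi.const_mul _).intervalIntegrable) fun k hk => ?_
          have hJ := exp_neg_mul_one_sub_cos_le ht (abs_le.2 ⟨by linarith [hk.1], hk.2⟩)
          have hx := sq_mul_exp_neg_le (show 0 ≤ b * k ^ 2 by positivity)
          calc k ^ 4 * Real.exp (-(t * (1 - Real.cos k)))
              ≤ k ^ 4 * Real.exp (-(2 * t / π ^ 2) * k ^ 2) := by gcongr
            _ = (b ^ 2)⁻¹ * ((b * k ^ 2) ^ 2 * Real.exp (-(b * k ^ 2))) := by
                rw [← hb, neg_mul]
                field_simp
            _ ≤ (b ^ 2)⁻¹ * (8 * Real.exp (-(b * k ^ 2 / 4))) := by gcongr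
            _ = 8 / b ^ 2 * Real.exp (-(b / 4) * k ^ 2) := by
                rw [show -(b * k ^ 2 / 4) = -(b / 4) * k ^ 2 by ring]
                ring
      _ ≤ ∫ k, 8 / b ^ 2 * Real.exp (-(b / 4) * k ^ 2) := by
          rw [intervalIntegral.integral_of_le hle]
          exact setIntegral_le_integral (hgi.const_mul _)
            (Eventually.of_forall fun k => by positivity)
      _ = 8 / b ^ 2 * Real.sqrt (π / (b / 4)) := by
          rw [MeasureTheory.integral_const_mul, integral_gaussian]
      _ = (2 * π ^ 4 * Real.sqrt (2 * π ^ 3)) * (t⁻¹ * t⁻¹ * t ^ (-(1 / 2 : ℝ))) := by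
          have e1 : 8 / b ^ 2 = 2 * π ^ 4 * (t⁻¹ * t⁻¹) := by rw [hb]; field_simp; ring
          have e2 : π / (b / 4) = (2 * π ^ 3) * t⁻¹ := by rw [hb]; field_simp; ring
          rw [e1, e2, Real.sqrt_mul (by positivity), Real.sqrt_inv, Real.rpow_neg ht0.le,
            Real.sqrt_eq_rpow t]
          ring
      _ ≤ 6144 * (t⁻¹ * t⁻¹ * t ^ (-(1 / 2 : ℝ))) := by
          refine mul_le_mul_of_nonneg_right ?_ (by positivity)
          have h3 : Real.sqrt (2 * π ^ 3) ≤ 12 := by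
            rw [show (12 : ℝ) = Real.sqrt (12 ^ 2) by rw [Real.sqrt_sq (by norm_num)]]
            exact Real.sqrt_le_sqrt (by nlinarith)
          calc 2 * π ^ 4 * Real.sqrt (2 * π ^ 3) ≤ 2 * 4 ^ 4 * 12 := by gcongr
            _ = 6144 := by norm_num

/-- **Third absolute moment of the heat weight**:
`∫_{-π}^{π} |k|³ e^{-t(1 - cos k)} dk ≤ 3136 (1∨t)⁻²` for `t ≥ 0` (from the second and fourth moments
through `|k|³ ≤ k⁴/(2s) + s k²/2`, `s = (1∨t)^{-1/2}`). [folklore] -/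
theorem integral_abs_pow_three_mul_exp_neg_mul_one_sub_cos_le {t : ℝ} (ht : 0 ≤ t) :
    ∫ k in (-π)..π, |k| ^ 3 * Real.exp (-(t * (1 - Real.cos k))) ≤
      3136 * ((max 1 t)⁻¹ * (max 1 t)⁻¹) := by
  have hle : (-π : ℝ) ≤ π := by linarith [Real.pi_pos]
  have I2 := integral_sq_mul_exp_neg_mul_one_sub_cos_le ht
  have I4 := integral_pow_four_mul_exp_neg_mul_one_sub_cos_le ht
  have hss := max_one_rpow_neg_half_mul_self t
  set T : ℝ := max 1 t with hT
  set s : ℝ := T ^ (-(1 / 2 : ℝ)) with hs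
  have hT0 : 0 < T := by positivity
  have hs0 : 0 < s := Real.rpow_pos_of_pos hT0 _
  have hamgm : ∀ k : ℝ, |k| ^ 3 ≤ (2 * s)⁻¹ * k ^ 4 + s / 2 * k ^ 2 := fun k => by
    have hk2 : |k| ^ 2 = k ^ 2 := sq_abs k
    have hk3 : |k| ^ 3 = |k| * k ^ 2 := by rw [← hk2]; ring
    have hk4 : k ^ 4 = k ^ 2 * k ^ 2 := by ring
    have h0 : 0 ≤ (k ^ 2 - s * |k|) ^ 2 := sq_nonneg _
    have h1 : |k| ^ 3 * (2 * s) ≤ k ^ 4 + s * s * k ^ 2 := by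
      rw [hk3, hk4]
      nlinarith [abs_nonneg k, hk2]
    calc |k| ^ 3 = |k| ^ 3 * (2 * s) * (2 * s)⁻¹ := by field_simp
      _ ≤ (k ^ 4 + s * s * k ^ 2) * (2 * s)⁻¹ := by gcongr
      _ = (2 * s)⁻¹ * k ^ 4 + s / 2 * k ^ 2 := by field_simp
  have hc2 : Continuous fun k : ℝ => k ^ 2 * Real.exp (-(t * (1 - Real.cos k))) := by fun_prop
  have hc3 : Continuous fun k : ℝ => |k| ^ 3 * Real.exp (-(t * (1 - Real.cos k))) := by fun_prop
  have hc4 : Continuous fun k : ℝ => k ^ 4 * Real.exp (-(t * (1 - Real.cos k))) := by fun_prop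
  calc ∫ k in (-π)..π, |k| ^ 3 * Real.exp (-(t * (1 - Real.cos k)))
      ≤ ∫ k in (-π)..π, ((2 * s)⁻¹ * (k ^ 4 * Real.exp (-(t * (1 - Real.cos k)))) +
          (s / 2) * (k ^ 2 * Real.exp (-(t * (1 - Real.cos k))))) := by
        refine intervalIntegral.integral_mono_on hle (hc3.intervalIntegrable _ _)
          (Continuous.intervalIntegrable (by fun_prop) _ _) fun k _ => ?_
        have hw : 0 ≤ Real.exp (-(t * (1 - Real.cos k))) := (Real.exp_pos _).le
        calc |k| ^ 3 * Real.exp (-(t * (1 - Real.cos k)))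
            ≤ ((2 * s)⁻¹ * k ^ 4 + s / 2 * k ^ 2) * Real.exp (-(t * (1 - Real.cos k))) :=
              mul_le_mul_of_nonneg_right (hamgm k) hw
          _ = _ := by ring
    _ = (2 * s)⁻¹ * (∫ k in (-π)..π, k ^ 4 * Real.exp (-(t * (1 - Real.cos k)))) +
          (s / 2) * ∫ k in (-π)..π, k ^ 2 * Real.exp (-(t * (1 - Real.cos k))) := by
        rw [intervalIntegral.integral_add ((hc4.const_mul _).intervalIntegrable _ _)
          ((hc2.const_mul _).intervalIntegrable _ _), intervalIntegral.integral_const_mul,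
          intervalIntegral.integral_const_mul]
    _ ≤ (2 * s)⁻¹ * (6144 * (T⁻¹ * T⁻¹ * s)) + (s / 2) * (128 * (T⁻¹ * s)) := by gcongr
    _ = 3136 * (T⁻¹ * T⁻¹) := by rw [← hss]; field_simp; ring

/-! ### The third difference as a shifted contour integral -/

/-- `F_{t,m-2}(z) = e^{-iz} e^{-iz} F_{t,m}(z)`. [folklore] -/
theorem srwHeatIntegrand_sub_two (t : ℝ) (m : ℤ) (z : ℂ) :
    srwHeatIntegrand t (m - 2) z =
      Complex.exp (-(Complex.I * z)) * (Complex.exp (-(Complex.I * z)) * srwHeatIntegrand t m z) := by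
  rw [← srwHeatIntegrand_sub_one, ← srwHeatIntegrand_sub_one]
  congr 1
  ring

/-- **The third difference as a shifted contour integral**:
`2π (q_t(m+1) - 3q_t(m) + 3q_t(m-1) - q_t(m-2)) = ∫_{-π}^{π} (e^{iz} - 1)(e^{-iz} - 1)² F_{t,m}(z) dk`,
`z = k + iλ`. [folklore] -/
theorem thirdDiff_srwHeatKernel_eq_integral (t : ℝ) (m : ℤ) (lam : ℝ) :
    (((2 * π * (srwHeatKernel t (m + 1) - 3 * srwHeatKernel t m + 3 * srwHeatKernel t (m - 1) -
        srwHeatKernel t (m - 2))) : ℝ) : ℂ) =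
      ∫ k in (-π)..π, ((Complex.exp (Complex.I * ((k : ℂ) + lam * Complex.I)) - 1) *
          (Complex.exp (-(Complex.I * ((k : ℂ) + lam * Complex.I))) - 1) ^ 2) *
        srwHeatIntegrand t m ((k : ℂ) + lam * Complex.I) := by
  have h1 := integral_srwHeatIntegrand_shift t (m + 1) lam
  have h2 := integral_srwHeatIntegrand_shift t m lam
  have h3 := integral_srwHeatIntegrand_shift t (m - 1) lam
  have h4 := integral_srwHeatIntegrand_shift t (m - 2) lam
  rw [integral_srwHeatIntegrand] at h1 h2 h3 h4
  have hc := continuous_srwHeatIntegrand_shift t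
  have hsplit : ∀ k : ℝ, ((Complex.exp (Complex.I * ((k : ℂ) + lam * Complex.I)) - 1) *
          (Complex.exp (-(Complex.I * ((k : ℂ) + lam * Complex.I))) - 1) ^ 2) *
        srwHeatIntegrand t m ((k : ℂ) + lam * Complex.I) =
      srwHeatIntegrand t (m + 1) ((k : ℂ) + lam * Complex.I) -
        3 * srwHeatIntegrand t m ((k : ℂ) + lam * Complex.I) +
        3 * srwHeatIntegrand t (m - 1) ((k : ℂ) + lam * Complex.I) -
        srwHeatIntegrand t (m - 2) ((k : ℂ) + lam * Complex.I) := fun k => by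
    rw [srwHeatIntegrand_add_one, srwHeatIntegrand_sub_one, srwHeatIntegrand_sub_two]
    have hee : Complex.exp (Complex.I * ((k : ℂ) + lam * Complex.I)) *
        Complex.exp (-(Complex.I * ((k : ℂ) + lam * Complex.I))) = 1 := by
      rw [← Complex.exp_add, add_neg_cancel, Complex.exp_zero]
    linear_combination (Complex.exp (-(Complex.I * ((k : ℂ) + lam * Complex.I))) - 2) *
      srwHeatIntegrand t m ((k : ℂ) + lam * Complex.I) * hee
  simp_rw [hsplit]
  have i1 : IntervalIntegrable (fun k : ℝ => srwHeatIntegrand t (m + 1) ((k : ℂ) + lam * Complex.I))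
      volume (-π) π := (hc _ _).intervalIntegrable _ _
  have i2 : IntervalIntegrable (fun k : ℝ => 3 * srwHeatIntegrand t m ((k : ℂ) + lam * Complex.I))
      volume (-π) π := ((hc _ _).const_mul _).intervalIntegrable _ _
  have i3 : IntervalIntegrable
      (fun k : ℝ => 3 * srwHeatIntegrand t (m - 1) ((k : ℂ) + lam * Complex.I))
      volume (-π) π := ((hc _ _).const_mul _).intervalIntegrable _ _
  have i4 : IntervalIntegrable (fun k : ℝ => srwHeatIntegrand t (m - 2) ((k : ℂ) + lam * Complex.I))
      volume (-π) π := (hc _ _).intervalIntegrable _ _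
  rw [intervalIntegral.integral_sub ((i1.sub i2).add i3) i4,
    intervalIntegral.integral_add (i1.sub i2) i3, intervalIntegral.integral_sub i1 i2,
    intervalIntegral.integral_const_mul, intervalIntegral.integral_const_mul, ← h1, ← h2, ← h3,
    ← h4]
  push_cast
  ring

/-- **Chernoff bound for the third difference**: for `t ≥ 0`, `m ∈ ℤ`, `|λ| ≤ 1`,
`2π |q_t(m+1) - 3q_t(m) + 3q_t(m-1) - q_t(m-2)| ≤ e^{-λm + t(cosh λ - 1)} (12544 (1∨t)⁻² + 32|λ|³ · 2π (1∨t)^{-1/2})`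
(the multiplier has modulus `≤ (|k| + 2|λ|)³ ≤ 4|k|³ + 32|λ|³`). [folklore] -/
theorem abs_thirdDiff_srwHeatKernel_le_exp {t : ℝ} (ht : 0 ≤ t) (m : ℤ) {lam : ℝ} (hl : |lam| ≤ 1) :
    2 * π * |srwHeatKernel t (m + 1) - 3 * srwHeatKernel t m + 3 * srwHeatKernel t (m - 1) -
        srwHeatKernel t (m - 2)| ≤
      Real.exp (-(lam * m) + t * (Real.cosh lam - 1)) *
        (12544 * ((max 1 t)⁻¹ * (max 1 t)⁻¹) +
          32 * |lam| ^ 3 * (2 * π * (max 1 t) ^ (-(1 / 2 : ℝ)))) := by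
  have hπ : 0 < 2 * π := by positivity
  have hnorm : 2 * π * |srwHeatKernel t (m + 1) - 3 * srwHeatKernel t m +
      3 * srwHeatKernel t (m - 1) - srwHeatKernel t (m - 2)| =
      ‖∫ k in (-π)..π, ((Complex.exp (Complex.I * ((k : ℂ) + lam * Complex.I)) - 1) *
          (Complex.exp (-(Complex.I * ((k : ℂ) + lam * Complex.I))) - 1) ^ 2) *
        srwHeatIntegrand t m ((k : ℂ) + lam * Complex.I)‖ := by
    rw [← thirdDiff_srwHeatKernel_eq_integral, Complex.norm_real, Real.norm_eq_abs, abs_mul,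
      abs_of_pos hπ]
  have hc0 : Continuous fun k : ℝ => Real.exp (-(t * (1 - Real.cos k))) := by fun_prop
  have hc3 : Continuous fun k : ℝ => |k| ^ 3 * Real.exp (-(t * (1 - Real.cos k))) := by fun_prop
  have hmult : ∀ k : ℝ, ‖(Complex.exp (Complex.I * ((k : ℂ) + lam * Complex.I)) - 1) *
      (Complex.exp (-(Complex.I * ((k : ℂ) + lam * Complex.I))) - 1) ^ 2‖ ≤
      4 * |k| ^ 3 + 32 * |lam| ^ 3 := by
    intro k
    rw [norm_mul, norm_pow]
    have ha := norm_cexp_I_mul_shift_sub_one_le k hl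
    have hb := norm_cexp_neg_I_mul_shift_sub_one_le k hl
    have h0 : 0 ≤ |k| + 2 * |lam| := by positivity
    calc ‖Complex.exp (Complex.I * ((k : ℂ) + lam * Complex.I)) - 1‖ *
          ‖Complex.exp (-(Complex.I * ((k : ℂ) + lam * Complex.I))) - 1‖ ^ 2
        ≤ (|k| + 2 * |lam|) * (|k| + 2 * |lam|) ^ 2 :=
          mul_le_mul ha (pow_le_pow_left₀ (norm_nonneg _) hb 2) (by positivity) h0
      _ = (|k| + 2 * |lam|) ^ 3 := by ring
      _ ≤ 4 * |k| ^ 3 + 32 * |lam| ^ 3 := by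
          nlinarith [abs_nonneg k, abs_nonneg lam, mul_nonneg h0 (sq_nonneg (|k| - 2 * |lam|))]
  have h := norm_integral_mul_srwHeatIntegrand_shift_le ht m lam
    (M := fun k => (Complex.exp (Complex.I * ((k : ℂ) + lam * Complex.I)) - 1) *
      (Complex.exp (-(Complex.I * ((k : ℂ) + lam * Complex.I))) - 1) ^ 2)
    (B := fun k => 4 * |k| ^ 3 + 32 * |lam| ^ 3) (by fun_prop) (by fun_prop) (fun k _ => hmult k)
  rw [hnorm]
  refine h.trans (mul_le_mul_of_nonneg_left ?_ (Real.exp_pos _).le)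
  have hsplit : ∫ k in (-π)..π, (4 * |k| ^ 3 + 32 * |lam| ^ 3) * Real.exp (-(t * (1 - Real.cos k))) =
      4 * (∫ k in (-π)..π, |k| ^ 3 * Real.exp (-(t * (1 - Real.cos k)))) +
        32 * |lam| ^ 3 * ∫ k in (-π)..π, Real.exp (-(t * (1 - Real.cos k))) := by
    rw [← intervalIntegral.integral_const_mul, ← intervalIntegral.integral_const_mul,
      ← intervalIntegral.integral_add ((hc3.const_mul _).intervalIntegrable _ _)
      ((hc0.const_mul _).intervalIntegrable _ _)]
    congr 1
    funext k
    ring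
  rw [hsplit]
  have I0 := integral_exp_neg_mul_one_sub_cos_le ht
  have I3 := integral_abs_pow_three_mul_exp_neg_mul_one_sub_cos_le ht
  calc 4 * (∫ k in (-π)..π, |k| ^ 3 * Real.exp (-(t * (1 - Real.cos k)))) +
        32 * |lam| ^ 3 * ∫ k in (-π)..π, Real.exp (-(t * (1 - Real.cos k)))
      ≤ 4 * (3136 * ((max 1 t)⁻¹ * (max 1 t)⁻¹)) +
        32 * |lam| ^ 3 * (2 * π * (max 1 t) ^ (-(1 / 2 : ℝ))) := by gcongr
    _ = _ := by ring

/-! ### Gaussian-weighted decay -/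

/-- **Decay of the third difference of the heat kernel**: for every `p : ℕ` there is `A > 0` with
`|q_t(m+1) - 3q_t(m) + 3q_t(m-1) - q_t(m-2)| ≤ A (1 ∨ t)⁻² (1 + m²/(1 ∨ t))^{-p}` for all `t > 0`,
`m ∈ ℤ` — three factors `(1 ∨ t)^{-1/2}` beyond the size of the kernel. [folklore] -/
theorem srwHeatKernel_thirdDiff_decay (p : ℕ) : ∃ A : ℝ, 0 < A ∧ ∀ t : ℝ, 0 < t → ∀ m : ℤ,
    |srwHeatKernel t (m + 1) - 3 * srwHeatKernel t m + 3 * srwHeatKernel t (m - 1) -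
        srwHeatKernel t (m - 2)| ≤
      A * ((max 1 t)⁻¹ * (max 1 t)⁻¹) * ((1 + (m : ℝ) ^ 2 / max 1 t) ^ p)⁻¹ := by
  have h2π : (0 : ℝ) < 2 * π := by positivity
  have hfour : ∀ t : ℝ, ((max 1 t) ^ (-(1 / 2 : ℝ))) ^ (3 + 1) = (max 1 t)⁻¹ * (max 1 t)⁻¹ := by
    intro t
    rw [show ((max 1 t) ^ (-(1 / 2 : ℝ))) ^ (3 + 1) =
      ((max 1 t) ^ (-(1 / 2 : ℝ)) * (max 1 t) ^ (-(1 / 2 : ℝ))) *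
        ((max 1 t) ^ (-(1 / 2 : ℝ)) * (max 1 t) ^ (-(1 / 2 : ℝ))) by ring,
      max_one_rpow_neg_half_mul_self t]
  obtain ⟨A, hA, h⟩ := decay_of_chernoff_bound
    (Φ := fun t m => 2 * π * (srwHeatKernel t (m + 1) - 3 * srwHeatKernel t m +
      3 * srwHeatKernel t (m - 1) - srwHeatKernel t (m - 2)))
    (X := 12544) (Y := 64 * π) (by norm_num) (by positivity) 3 p (fun t ht m lam hl => by
      have h1 := abs_thirdDiff_srwHeatKernel_le_exp ht.le m hl
      rw [abs_mul, abs_of_pos h2π]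
      convert h1 using 2
      rw [hfour t]
      ring)
  refine ⟨A / (2 * π), by positivity, fun t ht m => ?_⟩
  have h1 := h t ht m
  rw [abs_mul, abs_of_pos h2π, hfour t] at h1
  calc |srwHeatKernel t (m + 1) - 3 * srwHeatKernel t m + 3 * srwHeatKernel t (m - 1) -
        srwHeatKernel t (m - 2)|
      = (2 * π)⁻¹ * (2 * π * |srwHeatKernel t (m + 1) - 3 * srwHeatKernel t m +
          3 * srwHeatKernel t (m - 1) - srwHeatKernel t (m - 2)|) := by
        field_simp
    _ ≤ (2 * π)⁻¹ * (A * ((max 1 t)⁻¹ * (max 1 t)⁻¹) * ((1 + (m : ℝ) ^ 2 / max 1 t) ^ p)⁻¹) := by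
        gcongr
    _ = A / (2 * π) * ((max 1 t)⁻¹ * (max 1 t)⁻¹) * ((1 + (m : ℝ) ^ 2 / max 1 t) ^ p)⁻¹ := by
        ring

/-! ### Periodisation: the torus heat kernel -/

/-- **Third difference of the torus heat kernel**: there is `K > 0` such that for all `L ≥ 1`,
`0 < t ≤ L²` and `m ∈ ℤ/Lℤ`,
`|q^L_t(m+1) - 3q^L_t(m) + 3q^L_t(m-1) - q^L_t(m-2)| ≤ K (1∨t)⁻² (1 + m̃²/(1∨t))⁻³`. [folklore] -/
theorem abs_torusHeatKernel_thirdDiff_le : ∃ K : ℝ, 0 < K ∧ ∀ (L : ℕ) [NeZero L] (t : ℝ),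
    0 < t → t ≤ (L : ℝ) ^ 2 → ∀ m : ZMod L,
      |torusHeatKernel t (m + 1) - 3 * torusHeatKernel t m + 3 * torusHeatKernel t (m - 1) -
          torusHeatKernel t (m - 2)| ≤
      K * ((max 1 t)⁻¹ * (max 1 t)⁻¹) * ((1 + (m.valMinAbs : ℝ) ^ 2 / max 1 t) ^ 3)⁻¹ := by
  obtain ⟨A, hA, hq⟩ := srwHeatKernel_thirdDiff_decay 4
  have hS := one_le_tsum_inv_one_add_sq_div_four
  refine ⟨A * ∑' w : ℤ, (1 + (w : ℝ) ^ 2 / 4)⁻¹, by positivity, ?_⟩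
  intro L _ t ht htL m
  obtain ⟨hs0, hrep0⟩ := torusHeatKernel_eq_tsum (L := L) ht m.valMinAbs
  obtain ⟨hs1, hrep1⟩ := torusHeatKernel_eq_tsum (L := L) ht (m.valMinAbs + 1)
  obtain ⟨hs2, hrep2⟩ := torusHeatKernel_eq_tsum (L := L) ht (m.valMinAbs - 1)
  obtain ⟨hs3, hrep3⟩ := torusHeatKernel_eq_tsum (L := L) ht (m.valMinAbs - 2)
  rw [ZMod.coe_valMinAbs] at hrep0
  rw [Int.cast_add, Int.cast_one, ZMod.coe_valMinAbs] at hrep1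
  rw [Int.cast_sub, Int.cast_one, ZMod.coe_valMinAbs] at hrep2
  rw [Int.cast_sub, Int.cast_ofNat, ZMod.coe_valMinAbs] at hrep3
  rw [hrep0, hrep1, hrep2, hrep3, ← tsum_mul_left (a := 3), ← tsum_mul_left (a := 3),
    ← hs1.tsum_sub (hs0.mul_left 3), ← (hs1.sub (hs0.mul_left 3)).tsum_add (hs2.mul_left 3),
    ← ((hs1.sub (hs0.mul_left 3)).add (hs2.mul_left 3)).tsum_sub hs3]
  have e : ∀ w : ℤ, srwHeatKernel t (m.valMinAbs + 1 + w * L) -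
      3 * srwHeatKernel t (m.valMinAbs + w * L) + 3 * srwHeatKernel t (m.valMinAbs - 1 + w * L) -
      srwHeatKernel t (m.valMinAbs - 2 + w * L) =
      srwHeatKernel t (m.valMinAbs + w * L + 1) - 3 * srwHeatKernel t (m.valMinAbs + w * L) +
        3 * srwHeatKernel t (m.valMinAbs + w * L - 1) -
        srwHeatKernel t (m.valMinAbs + w * L - 2) := fun w => by
    rw [show m.valMinAbs + 1 + w * L = m.valMinAbs + w * L + 1 by ring,
      show m.valMinAbs - 1 + w * L = m.valMinAbs + w * L - 1 by ring,
      show m.valMinAbs - 2 + w * L = m.valMinAbs + w * L - 2 by ring]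
  simp_rw [e]
  have h := (abs_tsum_periodize_le
    (f := fun n => srwHeatKernel t (n + 1) - 3 * srwHeatKernel t n + 3 * srwHeatKernel t (n - 1) -
      srwHeatKernel t (n - 2))
    (B := A * ((max 1 t)⁻¹ * (max 1 t)⁻¹)) (by positivity) htL (fun n => hq t ht n) m).2
  calc _ ≤ _ := h
    _ = _ := by ring

end Summit.QuantumFields.YangMills.Theorems.SelfNormalisedSkewness.Negative
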